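import Literature.NumberTheory.LFunctions.ConreyIwaniec2002CircleMethodDefs
import Mathlib.MeasureTheory.Integral.IntervalIntegral.IntegrationByParts
import Mathlib.Analysis.SpecialFunctions.ExpDeriv
import Mathlib.Analysis.Complex.RealDeriv
import Mathlib.Analysis.Calculus.Deriv.Inv
import Mathlib.Analysis.Calculus.Deriv.Pow
import Mathlib.Analysis.Calculus.Deriv.Support
import Mathlib.Analysis.Fourier.FourierTransform
import HarnessLib

/-!
# Conrey–Iwaniec (2002), §4: "two partial integrations, no stationary phase" — the generic tools

B. Conrey, H. Iwaniec, *Spacing of zeros of Hecke L-functions and the class number problem*,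
Acta Arith. 103 (2002) 259–312, §4 (4.22)–(4.24) [held text `paper:arxiv-math_0111012`, p0012]:
the kernel bound (4.5)/(4.23) for the test functions `g` of (4.18) on `[X, 2X]` is obtained "by
partial integration two times" against a phase without stationary point. This file (cell
`landau-siegel/ls-inputs`, line `theta-circle-method`, towards the registered stub S3c
`stub_bessel_kernel`) provides the generic tools, over the tree's `IsBumpOn`:

* `integral_mul_cexp_eq_neg_integral`: one integration by parts against `e^{iφ}`,
  `∫_a^b B e^{iφ} = −∫_a^b (B/(iφ'))' e^{iφ}` when `φ' ≠ 0` and `B(a) = B(b) = 0`;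
* `norm_integral_mul_cexp_le_of_nonstationary`: for `A ∈ C²`, `φ ∈ C³` on `[a, b]` with
  `A = A' = 0` at the ends, `|φ'| ≥ μ > 0`, `|φ''| ≤ M₂`, `|φ'''| ≤ M₃`, `|A^{(j)}| ≤ a_j`:
  `|∫_a^b A e^{iφ}| ≤ (b − a)(a₂/μ² + 3a₁M₂/μ³ + a₀M₃/μ³ + 3a₀M₂²/μ⁴)`;
* `IsBumpOn.derivs`, `IsBumpOn.eq_zero_of_not_mem_Ioo` (a dyadic test function and its
  derivative vanish off the OPEN interval `(X, 2X)`), `IsBumpOn.bounds`;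
* `fourier_mul_eq_intervalIntegral_sq`: `𝓕(g·k)(α) = ∫_{√X}^{√(2X)} 2t e^{−2πiαt²}g(t²)k(t²)dt`
  (support + the substitution `x = t²`), and the trivial bound
  `norm_fourier_mul_le_of_norm_le_one`: `|𝓕(g·k)(α)| ≤ X` when `|k| ≤ 1`.

Mathlib: `intervalIntegral.integral_mul_deriv_eq_deriv_mul`,
`intervalIntegral.integral_deriv_smul_comp`, `Real.fourier_real_eq_integral_exp_smul`.

«The programme SEARCHES and TYPES; no claim about Landau–Siegel zeros, Theorems 1–2 of
arXiv:2211.02515 or a repaired Margin232 until a kernel theorem says so.»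

## References

* [ConreyIwaniec2002] B. Conrey, H. Iwaniec, *Spacing of zeros of Hecke L-functions and the class
  number problem*, Acta Arith. 103 (2002) 259–312, arXiv:math/0111012: §4 (4.5), (4.22)–(4.24).
* G. N. Watson, *A Treatise on the Theory of Bessel Functions* (2nd ed., 1944), §7.21 (Hankel's
  expansions; here replaced by the elementary envelope built from `J₀`, `J₁`).
-/

noncomputable section

open Complex Real Set MeasureTheory Filter intervalIntegral
open scoped Topology Interval FourierTransform

namespace Literature.NumberTheory.LFunctions

namespace ConreyIwaniec2002

/-- **One integration by parts against `e^{iφ}`** (no stationary point): if `φ' ≠ 0` on `[a, b]`,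
`B` vanishes at both ends and `t ↦ B(t)/(iφ'(t))` has the continuous derivative `D` on `[a, b]`,
then `∫_a^b B e^{iφ} = −∫_a^b D e^{iφ}` (write `B e^{iφ} = (B/(iφ'))·(e^{iφ})'`). [cite: ConreyIwaniec2002, §4 (4.23)] -/
theorem integral_mul_cexp_eq_neg_integral {a b : ℝ} (hab : a ≤ b) {B D : ℝ → ℂ} {φ φ' : ℝ → ℝ}
    (hφ : ∀ t ∈ Icc a b, HasDerivAt φ (φ' t) t) (hφ'c : ContinuousOn φ' (Icc a b))
    (hφ'0 : ∀ t ∈ Icc a b, φ' t ≠ 0)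
    (hBD : ∀ t ∈ Icc a b, HasDerivAt (fun s ↦ B s / (I * φ' s)) (D t) t)
    (hD : ContinuousOn D (Icc a b)) (hBa : B a = 0) (hBb : B b = 0) :
    ∫ t in a..b, B t * cexp (I * φ t) = -∫ t in a..b, D t * cexp (I * φ t) := by
  have hIcc : uIcc a b = Icc a b := uIcc_of_le hab
  -- the derivative of `e^{iφ}`
  have hE : ∀ t ∈ uIcc a b, HasDerivAt (fun s ↦ cexp (I * φ s)) (I * φ' t * cexp (I * φ t)) t := by
    intro t ht
    rw [hIcc] at ht
    have h1 : HasDerivAt (fun s ↦ I * (φ s : ℂ)) (I * φ' t) t := ((hφ t ht).ofReal_comp).const_mul I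
    have h2 := h1.cexp
    refine h2.congr_deriv ?_
    ring
  have hφc : ContinuousOn φ (Icc a b) := fun t ht ↦ (hφ t ht).continuousAt.continuousWithinAt
  have hEc : ContinuousOn (fun s ↦ cexp (I * φ s)) (Icc a b) :=
    (continuous_ofReal.comp_continuousOn hφc |>.const_smul I |>.cexp).congr (fun t _ ↦ by
      simp [smul_eq_mul])
  have hE'int : IntervalIntegrable (fun t ↦ I * φ' t * cexp (I * φ t)) volume a b := by
    refine ContinuousOn.intervalIntegrable ?_
    rw [hIcc]
    exact ((continuous_ofReal.comp_continuousOn hφ'c).const_smul I |>.congr (fun t _ ↦ by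
      simp [smul_eq_mul])).mul hEc
  have hDint : IntervalIntegrable D volume a b := by
    refine ContinuousOn.intervalIntegrable ?_
    rwa [hIcc]
  have hu : ∀ t ∈ uIcc a b, HasDerivAt (fun s ↦ B s / (I * φ' s)) (D t) t := by
    intro t ht; rw [hIcc] at ht; exact hBD t ht
  have key := integral_mul_deriv_eq_deriv_mul hu hE hDint hE'int
  -- rewrite the left integrand
  have hL : ∫ t in a..b, B t * cexp (I * φ t) =
      ∫ t in a..b, B t / (I * φ' t) * (I * φ' t * cexp (I * φ t)) := by
    refine integral_congr fun t ht ↦ ?_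
    rw [hIcc] at ht
    have h0 : (I * φ' t : ℂ) ≠ 0 := mul_ne_zero I_ne_zero (ofReal_ne_zero.mpr (hφ'0 t ht))
    rw [← mul_assoc, div_mul_cancel₀ _ h0]
  rw [hL, key, hBa, hBb]
  simp


/-- **Two integrations by parts without stationary phase** ("first derivative test" with two
derivatives of the amplitude): if `A ∈ C²` and `φ ∈ C³` on `[a, b]`, `A` and `A'` vanish at both
ends, `|φ'| ≥ μ > 0`, `|φ''| ≤ M₂`, `|φ'''| ≤ M₃`, `|A| ≤ a₀`, `|A'| ≤ a₁`, `|A''| ≤ a₂` on `[a, b]`,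
then `|∫_a^b A(t)e^{iφ(t)}dt| ≤ (b − a)(a₂/μ² + 3a₁M₂/μ³ + a₀M₃/μ³ + 3a₀M₂²/μ⁴)`: indeed
`∫ A e^{iφ} = ∫ T²A·e^{iφ}` with `TA = (A/(iφ'))'`, and
`T²A = −A''/φ'² + Aφ'''/φ'³ + 3A'φ''/φ'³ − 3Aφ''²/φ'⁴`. [cite: ConreyIwaniec2002, §4 (4.23)] -/
theorem norm_integral_mul_cexp_le_of_nonstationary {a b : ℝ} (hab : a ≤ b)
    {A A' A'' : ℝ → ℂ} {φ φ' φ'' φ''' : ℝ → ℝ}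
    (hA : ∀ t ∈ Icc a b, HasDerivAt A (A' t) t) (hA' : ∀ t ∈ Icc a b, HasDerivAt A' (A'' t) t)
    (hA''c : ContinuousOn A'' (Icc a b))
    (hφ : ∀ t ∈ Icc a b, HasDerivAt φ (φ' t) t) (hφ' : ∀ t ∈ Icc a b, HasDerivAt φ' (φ'' t) t)
    (hφ'' : ∀ t ∈ Icc a b, HasDerivAt φ'' (φ''' t) t) (hφ'''c : ContinuousOn φ''' (Icc a b))
    (hAa : A a = 0) (hAb : A b = 0) (hA'a : A' a = 0) (hA'b : A' b = 0)
    {μ M₂ M₃ a₀ a₁ a₂ : ℝ} (hμ : 0 < μ) (hμφ : ∀ t ∈ Icc a b, μ ≤ |φ' t|)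
    (hM₂ : ∀ t ∈ Icc a b, |φ'' t| ≤ M₂) (hM₃ : ∀ t ∈ Icc a b, |φ''' t| ≤ M₃)
    (ha₀ : ∀ t ∈ Icc a b, ‖A t‖ ≤ a₀) (ha₁ : ∀ t ∈ Icc a b, ‖A' t‖ ≤ a₁)
    (ha₂ : ∀ t ∈ Icc a b, ‖A'' t‖ ≤ a₂) :
    ‖∫ t in a..b, A t * cexp (I * φ t)‖ ≤
      (b - a) * (a₂ / μ ^ 2 + 3 * a₁ * M₂ / μ ^ 3 + a₀ * M₃ / μ ^ 3 + 3 * a₀ * M₂ ^ 2 / μ ^ 4) := by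
  -- nonvanishing of `φ'`, continuity of everything
  have hφ'0 : ∀ t ∈ Icc a b, φ' t ≠ 0 := fun t ht h ↦ by
    have := hμφ t ht; rw [h, abs_zero] at this; linarith
  have hφ'C : ∀ t ∈ Icc a b, (φ' t : ℂ) ≠ 0 := fun t ht ↦ ofReal_ne_zero.mpr (hφ'0 t ht)
  have hIφ'C : ∀ t ∈ Icc a b, (I * φ' t : ℂ) ≠ 0 := fun t ht ↦ mul_ne_zero I_ne_zero (hφ'C t ht)
  have hAc : ContinuousOn A (Icc a b) := fun t ht ↦ (hA t ht).continuousAt.continuousWithinAt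
  have hA'c : ContinuousOn A' (Icc a b) := fun t ht ↦ (hA' t ht).continuousAt.continuousWithinAt
  have hφ'c : ContinuousOn φ' (Icc a b) := fun t ht ↦ (hφ' t ht).continuousAt.continuousWithinAt
  have hφ''c : ContinuousOn φ'' (Icc a b) :=
    fun t ht ↦ (hφ'' t ht).continuousAt.continuousWithinAt
  have hφ'cC : ContinuousOn (fun t ↦ (φ' t : ℂ)) (Icc a b) :=
    continuous_ofReal.comp_continuousOn hφ'c
  have hφ''cC : ContinuousOn (fun t ↦ (φ'' t : ℂ)) (Icc a b) :=
    continuous_ofReal.comp_continuousOn hφ''c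
  have hφ'''cC : ContinuousOn (fun t ↦ (φ''' t : ℂ)) (Icc a b) :=
    continuous_ofReal.comp_continuousOn hφ'''c
  -- complexified derivatives of `φ'`, `φ''`
  have hdφ' : ∀ t ∈ Icc a b, HasDerivAt (fun s ↦ (φ' s : ℂ)) (φ'' t : ℂ) t :=
    fun t ht ↦ (hφ' t ht).ofReal_comp
  have hdφ'' : ∀ t ∈ Icc a b, HasDerivAt (fun s ↦ (φ'' s : ℂ)) (φ''' t : ℂ) t :=
    fun t ht ↦ (hφ'' t ht).ofReal_comp
  have hdIφ' : ∀ t ∈ Icc a b, HasDerivAt (fun s ↦ I * (φ' s : ℂ)) (I * φ'' t) t :=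
    fun t ht ↦ (hdφ' t ht).const_mul I
  -- first step: `T A = D₁`
  set D₁ : ℝ → ℂ := fun t ↦ (A' t * φ' t - A t * φ'' t) / (I * (φ' t : ℂ) ^ 2) with hD₁
  have hD₁d : ∀ t ∈ Icc a b, HasDerivAt (fun s ↦ A s / (I * φ' s)) (D₁ t) t := by
    intro t ht
    have h := (hA t ht).fun_div (hdIφ' t ht) (hIφ'C t ht)
    refine h.congr_deriv ?_
    have h0 := hφ'C t ht
    rw [hD₁]
    field_simp
  have hD₁c : ContinuousOn D₁ (Icc a b) := by
    refine ContinuousOn.div ?_ ?_ (fun t ht ↦ mul_ne_zero I_ne_zero (pow_ne_zero 2 (hφ'C t ht)))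
    · exact (hA'c.mul hφ'cC).sub (hAc.mul hφ''cC)
    · exact continuousOn_const.mul (hφ'cC.pow 2)
  have hD₁a : D₁ a = 0 := by simp [hD₁, hAa, hA'a]
  have hD₁b : D₁ b = 0 := by simp [hD₁, hAb, hA'b]
  have step1 := integral_mul_cexp_eq_neg_integral hab hφ hφ'c hφ'0 hD₁d hD₁c hAa hAb
  -- second step: `T D₁ = D₂`
  set D₂ : ℝ → ℂ := fun t ↦ -A'' t / (φ' t : ℂ) ^ 2 + A t * φ''' t / (φ' t : ℂ) ^ 3 +
      3 * A' t * φ'' t / (φ' t : ℂ) ^ 3 - 3 * A t * (φ'' t : ℂ) ^ 2 / (φ' t : ℂ) ^ 4 with hD₂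
  have hD₂d : ∀ t ∈ Icc a b, HasDerivAt (fun s ↦ D₁ s / (I * φ' s)) (D₂ t) t := by
    intro t ht
    have hN : HasDerivAt (fun s ↦ A' s * (φ' s : ℂ) - A s * φ'' s)
        (A'' t * φ' t + A' t * φ'' t - (A' t * φ'' t + A t * φ''' t)) t :=
      ((hA' t ht).fun_mul (hdφ' t ht)).fun_sub ((hA t ht).fun_mul (hdφ'' t ht))
    have hDen : HasDerivAt (fun s ↦ I * (φ' s : ℂ) ^ 2) (I * (2 * (φ' t : ℂ) ^ 1 * φ'' t)) t :=
      ((hdφ' t ht).fun_pow 2).const_mul I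
    have hD₁' := hN.fun_div hDen (mul_ne_zero I_ne_zero (pow_ne_zero 2 (hφ'C t ht)))
    have h := hD₁'.fun_div (hdIφ' t ht) (hIφ'C t ht)
    refine h.congr_deriv ?_
    have h0 := hφ'C t ht
    rw [hD₂]
    field_simp
    ring_nf
    rw [I_sq]
    ring
  have hD₂c : ContinuousOn D₂ (Icc a b) := by
    have h2 : ∀ t ∈ Icc a b, (φ' t : ℂ) ^ 2 ≠ 0 := fun t ht ↦ pow_ne_zero 2 (hφ'C t ht)
    have h3 : ∀ t ∈ Icc a b, (φ' t : ℂ) ^ 3 ≠ 0 := fun t ht ↦ pow_ne_zero 3 (hφ'C t ht)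
    have h4 : ∀ t ∈ Icc a b, (φ' t : ℂ) ^ 4 ≠ 0 := fun t ht ↦ pow_ne_zero 4 (hφ'C t ht)
    refine ((ContinuousOn.add (ContinuousOn.add ?_ ?_) ?_).sub ?_)
    · exact hA''c.neg.div (hφ'cC.pow 2) h2
    · exact (hAc.mul hφ'''cC).div (hφ'cC.pow 3) h3
    · exact ((continuousOn_const.mul hA'c).mul hφ''cC).div (hφ'cC.pow 3) h3
    · exact ((continuousOn_const.mul hAc).mul (hφ''cC.pow 2)).div (hφ'cC.pow 4) h4
  have step2 := integral_mul_cexp_eq_neg_integral hab hφ hφ'c hφ'0 hD₂d hD₂c hD₁a hD₁b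
  rw [step1, step2, neg_neg]
  -- the pointwise bound
  have hnn : 0 ≤ a₀ ∧ 0 ≤ a₁ ∧ 0 ≤ a₂ ∧ 0 ≤ M₂ ∧ 0 ≤ M₃ := by
    have ha := left_mem_Icc.mpr hab
    exact ⟨(norm_nonneg _).trans (ha₀ a ha), (norm_nonneg _).trans (ha₁ a ha),
      (norm_nonneg _).trans (ha₂ a ha), (abs_nonneg _).trans (hM₂ a ha),
      (abs_nonneg _).trans (hM₃ a ha)⟩
  obtain ⟨h0a₀, h0a₁, h0a₂, h0M₂, h0M₃⟩ := hnn
  have hpt : ∀ t ∈ Ι a b, ‖D₂ t * cexp (I * φ t)‖ ≤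
      a₂ / μ ^ 2 + 3 * a₁ * M₂ / μ ^ 3 + a₀ * M₃ / μ ^ 3 + 3 * a₀ * M₂ ^ 2 / μ ^ 4 := by
    intro t ht
    have ht' : t ∈ Icc a b := by
      rw [uIoc_of_le hab] at ht; exact ⟨ht.1.le, ht.2⟩
    have hE : ‖cexp (I * φ t)‖ = 1 := by rw [norm_exp]; simp
    rw [norm_mul, hE, mul_one]
    have hφn : ‖(φ' t : ℂ)‖ = |φ' t| := by rw [Complex.norm_real, Real.norm_eq_abs]
    have hφ''n : ‖(φ'' t : ℂ)‖ = |φ'' t| := by rw [Complex.norm_real, Real.norm_eq_abs]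
    have hφ'''n : ‖(φ''' t : ℂ)‖ = |φ''' t| := by rw [Complex.norm_real, Real.norm_eq_abs]
    have hμt := hμφ t ht'
    have hpos : 0 < |φ' t| := lt_of_lt_of_le hμ hμt
    have hp2 : μ ^ 2 ≤ |φ' t| ^ 2 := pow_le_pow_left₀ hμ.le hμt 2
    have hp3 : μ ^ 3 ≤ |φ' t| ^ 3 := pow_le_pow_left₀ hμ.le hμt 3
    have hp4 : μ ^ 4 ≤ |φ' t| ^ 4 := pow_le_pow_left₀ hμ.le hμt 4
    -- the four terms
    have t1 : ‖-A'' t / (φ' t : ℂ) ^ 2‖ ≤ a₂ / μ ^ 2 := by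
      rw [norm_div, norm_neg, norm_pow, hφn]
      exact div_le_div₀ h0a₂ (ha₂ t ht') (by positivity) hp2
    have t2 : ‖A t * φ''' t / (φ' t : ℂ) ^ 3‖ ≤ a₀ * M₃ / μ ^ 3 := by
      rw [norm_div, norm_mul, norm_pow, hφn, hφ'''n]
      exact div_le_div₀ (by positivity) (mul_le_mul (ha₀ t ht') (hM₃ t ht') (abs_nonneg _) h0a₀)
        (by positivity) hp3
    have t3 : ‖3 * A' t * φ'' t / (φ' t : ℂ) ^ 3‖ ≤ 3 * a₁ * M₂ / μ ^ 3 := by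
      rw [norm_div, norm_mul, norm_mul, norm_pow, hφn, hφ''n, Complex.norm_ofNat]
      refine div_le_div₀ (by positivity) ?_ (by positivity) hp3
      exact mul_le_mul (mul_le_mul_of_nonneg_left (ha₁ t ht') (by norm_num)) (hM₂ t ht')
        (abs_nonneg _) (by positivity)
    have t4 : ‖3 * A t * (φ'' t : ℂ) ^ 2 / (φ' t : ℂ) ^ 4‖ ≤ 3 * a₀ * M₂ ^ 2 / μ ^ 4 := by
      rw [norm_div, norm_mul, norm_mul, norm_pow, norm_pow, hφn, hφ''n, Complex.norm_ofNat]
      refine div_le_div₀ (by positivity) ?_ (by positivity) hp4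
      exact mul_le_mul (mul_le_mul_of_nonneg_left (ha₀ t ht') (by norm_num))
        (pow_le_pow_left₀ (abs_nonneg _) (hM₂ t ht') 2) (by positivity) (by positivity)
    calc ‖D₂ t‖ ≤ ‖-A'' t / (φ' t : ℂ) ^ 2 + A t * φ''' t / (φ' t : ℂ) ^ 3 +
          3 * A' t * φ'' t / (φ' t : ℂ) ^ 3‖ + ‖3 * A t * (φ'' t : ℂ) ^ 2 / (φ' t : ℂ) ^ 4‖ :=
          norm_sub_le _ _
      _ ≤ ‖-A'' t / (φ' t : ℂ) ^ 2‖ + ‖A t * φ''' t / (φ' t : ℂ) ^ 3‖ +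
          ‖3 * A' t * φ'' t / (φ' t : ℂ) ^ 3‖ + ‖3 * A t * (φ'' t : ℂ) ^ 2 / (φ' t : ℂ) ^ 4‖ := by
          gcongr
          exact (norm_add_le _ _).trans (by gcongr; exact norm_add_le _ _)
      _ ≤ a₂ / μ ^ 2 + a₀ * M₃ / μ ^ 3 + 3 * a₁ * M₂ / μ ^ 3 + 3 * a₀ * M₂ ^ 2 / μ ^ 4 := by
          gcongr
      _ = a₂ / μ ^ 2 + 3 * a₁ * M₂ / μ ^ 3 + a₀ * M₃ / μ ^ 3 + 3 * a₀ * M₂ ^ 2 / μ ^ 4 := by ring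
  have := norm_integral_le_of_norm_le_const hpt
  rw [abs_of_nonneg (sub_nonneg.mpr hab)] at this
  linarith [this]

section Bump

variable {X : ℝ} {g : ℝ → ℂ}

/-- A dyadic test function is `C²`: `g`, `g'` differentiable, `g''` continuous, and
`iteratedDeriv 1 g = g'`, `iteratedDeriv 2 g = g''`. [cite: ConreyIwaniec2002, §4 (4.18)] -/
theorem IsBumpOn.derivs (hg : IsBumpOn X g) :
    Differentiable ℝ g ∧ Differentiable ℝ (deriv g) ∧ Continuous (deriv (deriv g)) := by
  have h2 : ContDiff ℝ (1 + 1 : WithTop ℕ∞) g := by rw [one_add_one_eq_two]; exact hg.1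
  rw [contDiff_succ_iff_deriv] at h2
  have h1 : ContDiff ℝ (0 + 1 : WithTop ℕ∞) (deriv g) := by rw [zero_add]; exact h2.2.2
  rw [contDiff_succ_iff_deriv] at h1
  exact ⟨h2.1, h1.1, contDiff_zero.1 h1.2.2⟩

/-- For a dyadic test function on `[X, 2X]`: `g` and `g'` vanish outside the OPEN
interval `(X, 2X)` (by continuity at the endpoints). [cite: ConreyIwaniec2002, §4 (4.18)] -/
theorem IsBumpOn.eq_zero_of_not_mem_Ioo (hg : IsBumpOn X g) {x : ℝ}
    (hx : x ∉ Ioo X (2 * X)) : g x = 0 ∧ deriv g x = 0 := by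
  obtain ⟨hd, hd1, -⟩ := hg.derivs
  -- `g` and `g'` vanish on the open complement of `[X, 2X]`
  have hopen : IsOpen ((Icc X (2 * X))ᶜ) := isClosed_Icc.isOpen_compl
  have hg0 : ∀ y ∈ (Icc X (2 * X))ᶜ, g y = 0 := fun y hy ↦ hg.2.1 y hy
  have hg'0 : ∀ y ∈ (Icc X (2 * X))ᶜ, deriv g y = 0 := by
    intro y hy
    have hev : g =ᶠ[𝓝 y] fun _ ↦ (0 : ℂ) :=
      Filter.eventuallyEq_of_mem (hopen.mem_nhds hy) hg0
    rw [hev.deriv_eq, deriv_const]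
  -- the zero sets are closed and contain the closure of the complement
  have hcl : closure ((Icc X (2 * X))ᶜ) = (Ioo X (2 * X))ᶜ := by
    rw [closure_compl, interior_Icc]
  have hxcl : x ∈ closure ((Icc X (2 * X))ᶜ) := by rw [hcl]; exact hx
  constructor
  · have hclosed : IsClosed {y | g y = 0} := isClosed_eq hd.continuous continuous_const
    exact (hclosed.closure_subset_iff.mpr hg0) hxcl
  · have hclosed : IsClosed {y | deriv g y = 0} := isClosed_eq hd1.continuous continuous_const
    exact (hclosed.closure_subset_iff.mpr hg'0) hxcl

/-- Pointwise bounds for a dyadic test function at `x > 0` in `[X, 2X]`… in fact everywhere on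
`(0, ∞)`: `‖g x‖ ≤ 1`, `x‖g'(x)‖ ≤ 1`, `x²‖g''(x)‖ ≤ 1`. [cite: ConreyIwaniec2002, §4 (4.18)] -/
theorem IsBumpOn.bounds (hg : IsBumpOn X g) (x : ℝ) :
    ‖g x‖ ≤ 1 ∧ x * ‖deriv g x‖ ≤ 1 ∧ x ^ 2 * ‖deriv (deriv g) x‖ ≤ 1 := by
  refine ⟨?_, ?_, ?_⟩
  · simpa using hg.2.2 0 (by norm_num) x
  · simpa using hg.2.2 1 (by norm_num) x
  · have h := hg.2.2 2 le_rfl x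
    rwa [iteratedDeriv_succ, iteratedDeriv_one] at h

end Bump

section Fourier

variable {X : ℝ} {g : ℝ → ℂ}

/-- `‖𝓕 f α‖ ≤ ∫‖f‖`. [folklore] -/
private theorem norm_fourier_le_integral_norm (f : ℝ → ℂ) (α : ℝ) : ‖𝓕 f α‖ ≤ ∫ v : ℝ, ‖f v‖ := by
  rw [Real.fourier_real_eq]
  refine (MeasureTheory.norm_integral_le_integral_norm _).trans (le_of_eq ?_)
  congr 1 with v
  rw [Circle.smul_def, norm_smul, Circle.norm_coe, one_mul]

/-- `∫‖f‖ ≤ M·X` when `‖f‖ ≤ M` on `[X, 2X]` and `f = 0` off it (`X ≥ 0`). [folklore] -/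
private theorem integral_norm_le_of_supported (hX : 0 ≤ X) {f : ℝ → ℂ} {M : ℝ}
    (hin : ∀ x ∈ Icc X (2 * X), ‖f x‖ ≤ M) (hout : ∀ x ∉ Icc X (2 * X), f x = 0) :
    ∫ v : ℝ, ‖f v‖ ≤ M * X := by
  have hle : ∀ v : ℝ, ‖f v‖ ≤ (Icc X (2 * X)).indicator (fun _ ↦ M) v := by
    intro v
    by_cases hv : v ∈ Icc X (2 * X)
    · rw [indicator_of_mem hv]; exact hin v hv
    · rw [indicator_of_notMem hv, hout v hv, norm_zero]
  have hint : Integrable ((Icc X (2 * X)).indicator fun _ : ℝ ↦ M) volume :=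
    (continuous_const.integrableOn_Icc (μ := volume)).integrable_indicator measurableSet_Icc
  calc ∫ v : ℝ, ‖f v‖ ≤ ∫ v : ℝ, (Icc X (2 * X)).indicator (fun _ ↦ M) v :=
        integral_mono_of_nonneg (Filter.Eventually.of_forall fun v ↦ norm_nonneg _) hint
          (Filter.Eventually.of_forall hle)
    _ = M * X := by
        rw [integral_indicator_const _ measurableSet_Icc, Real.volume_real_Icc_of_le (by linarith),
          smul_eq_mul]
        ring

/-- **The trivial bound**: `|𝓕(g·k)(α)| ≤ X` for a dyadic test function `g` on `[X, 2X]` and a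
kernel with `|k| ≤ 1` (e.g. `J₀`). [cite: ConreyIwaniec2002, §4 (4.23)] -/
theorem norm_fourier_mul_le_of_norm_le_one (hX : 0 ≤ X) (hg : IsBumpOn X g) {k : ℝ → ℂ}
    (hk : ∀ x, ‖k x‖ ≤ 1) (α : ℝ) : ‖𝓕 (fun x ↦ g x * k x) α‖ ≤ X := by
  refine (norm_fourier_le_integral_norm _ α).trans ?_
  have := integral_norm_le_of_supported hX (f := fun x ↦ g x * k x) (M := 1)
    (fun x _ ↦ by
      rw [norm_mul]
      exact mul_le_one₀ ((hg.bounds x).1) (norm_nonneg _) (hk x))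
    (fun x hx ↦ by simp [hg.2.1 x hx])
  simpa using this

/-- **The Fourier integral along `x = t²`.** For a dyadic test function `g` on `[X, 2X]`
(`X > 0`) and a continuous kernel `k`:
`𝓕(g·k)(α) = ∫_{√X}^{√(2X)} 2t·e^{−2πiαt²}g(t²)k(t²)dt` (the integrand vanishes off `[X, 2X]`;
substitution `x = t²`, Mathlib `intervalIntegral.integral_deriv_smul_comp`). [cite: ConreyIwaniec2002, §4 (4.23)] -/
theorem fourier_mul_eq_intervalIntegral_sq (hX : 0 < X) (hg : IsBumpOn X g) {k : ℝ → ℂ}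
    (hk : Continuous k) (α : ℝ) :
    𝓕 (fun x ↦ g x * k x) α =
      ∫ t in Real.sqrt X..Real.sqrt (2 * X),
        (2 * t : ℝ) • (cexp (((-2 * Real.pi * t ^ 2 * α : ℝ) : ℂ) * I) * (g (t ^ 2) * k (t ^ 2))) := by
  rw [Real.fourier_real_eq_integral_exp_smul]
  set F : ℝ → ℂ := fun x ↦ cexp (((-2 * Real.pi * x * α : ℝ) : ℂ) * I) * (g x * k x) with hF
  have hgc : Continuous g := hg.derivs.1.continuous
  have hFc : Continuous F := by
    refine (Continuous.cexp ?_).mul (hgc.mul hk)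
    exact (continuous_ofReal.comp (by fun_prop)).mul continuous_const
  -- restrict to `[X, 2X]`
  have h1 : (∫ v : ℝ, cexp (((-2 * Real.pi * v * α : ℝ) : ℂ) * I) • (g v * k v)) =
      ∫ v in X..2 * X, F v := by
    have hzero : ∀ v, v ∉ Icc X (2 * X) → F v = 0 := fun v hv ↦ by
      simp [hF, hg.2.1 v hv]
    rw [intervalIntegral.integral_of_le (by linarith), ← integral_Icc_eq_integral_Ioc,
      setIntegral_eq_integral_of_forall_compl_eq_zero hzero]
    simp [hF, smul_eq_mul]
  rw [h1]
  -- substitute `x = t²`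
  have hsub := intervalIntegral.integral_deriv_smul_comp (a := Real.sqrt X) (b := Real.sqrt (2 * X))
    (f := fun t : ℝ ↦ t ^ 2) (f' := fun t : ℝ ↦ 2 * t) (g := F)
    (fun t _ ↦ by simpa using hasDerivAt_pow 2 t) (by fun_prop) hFc
  rw [Real.sq_sqrt hX.le, Real.sq_sqrt (by linarith)] at hsub
  rw [← hsub]
  refine intervalIntegral.integral_congr fun t _ ↦ ?_
  simp only [Function.comp_apply, hF]

end Fourier

end ConreyIwaniec2002

end Literature.NumberTheory.LFunctions

end
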